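import Summits.QuantumFields.BalabanUV.Beta.GAN24.S3DiffLt
import Summits.QuantumFields.BalabanUV.Beta.GAN24.TopLagrangeKSlotLipAt
import Summits.QuantumFields.BalabanUV.Beta.GAN24.KSlotAssembly

/-!
# `BalabanUV.Beta.GAN24.S3DiffLtAt` — binder row G-an2-4 / (CONV-C), S-slot, rows S3-Lt ∕ R3-dLt AT THE IN-BLOCK ROOT `r` (END): **`diffLt_three_at`** — for every
# in-block root `r ∈ box (3+1) Lc` and every `n`, the one-step difference of the unit-rescaled ROOTED top Λ pieces of members `n+3` and `n+2`
# (`lagrIncAt 3 (toSite r) Lc`) is `≤ cLt·θ^{n+1}` entrywise, ONE `(cLt, θ)` FOR ALL ROOTS, `θ` = the K-slot's own rate (twin of leaf-04 g19's `S3DiffLt`;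
# also the rooted SHAPE row `shapeLt_of_unitDecayK`)

NOT IN PRINT; OUR PROOF ATTEMPT (of the base row; THIS file is [folklore] bookkeeping).  HONEST FRAMING (cell contract, verbatim): «discharging `BetaPertH` makes
Bałaban's UV stability UNCONDITIONAL — a real constructive-QFT result; it is NOT the continuum limit and NOT the Clay problem.»  HONEST DEPENDENCY (verbatim):
«continuum YM on T⁴ ⇐ BetaPertH ∧ nine spine estimates (0/9 proved); BetaPertH ⇐ (D1) ∧ (D4) ∧ CAP+tail; G-an2-4 gates asym, D1 and NE2/3/4.»  The base proofs
VERBATIM over this lineage's `TopLagrangeKSlotAt.unit_e3OfS_lamTop_eq` ∕ `TopLagrangeKSlotLipAt.{biLoc_lamTopKer, biLoc_lamTopKer_sub}` and the root-free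
`S3DiffLt.{lipKerConst_mul, lipKerConst_nonneg}`, `TopLagrangeKSlotLip.{kerConst, lipKerConst}`, road P1's `KSlotAssembly.convCKWall_holds` BY NAME; 0 `def`, 0 cite,
0 `def … : Prop`, 0 sorry; nothing of the base module is edited.  NO (N1), NO (N1-Cauchy).  Discharges NOTHING of (hS, hSall) ∕ hBdev by itself (the junction with the
socket's pair letter is the owner's Q22-type identity `BornLambdaUndressedRow.lineage_top_pin_apply` at both members — NOT here); NEVER «G-an2-4 closed»; NOT
(CONV-C) as typed, NOT D1, NOT BetaPertH, NOT continuum, NOT Clay.  «ROOTED-S3-Λ-DIFF», `b2b-balaban-gan24-formalise-leaf-06` gen 41.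
-/

noncomputable section

open Finset
open scoped BigOperators
open Literature.MathematicalPhysics.QuantumFieldTheory
open Literature.MathematicalPhysics.QuantumFieldTheory.Balaban1983to89
open Literature.MathematicalPhysics.QuantumFieldTheory.Balaban1983to89.Beta
open B12Sec2to5 (l1 l1_nonneg)
open ExpKernelCalculus (MKer Decays BiLoc Zl Zl_nonneg)
open OneStepResolventKernel (Fib LocStencil)
open OneStepKernelFamily (KInvStep)
open AffineAveraging (box toSite)
open Summit.QuantumFields.BalabanUV.Beta.SpineRooted (lagrIncAt)
open Summit.QuantumFields.BalabanUV.Beta.HessKerDressedUnits (unitK)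
open Summit.QuantumFields.BalabanUV.Beta.GAN24.CombesThomas (SupBound UnitDecayK CauchyDecayK ConvCKWall sfStep smStep)
open Summit.QuantumFields.BalabanUV.Beta.GAN24.E3UnitSplit (e3OfS)
open Summit.QuantumFields.BalabanUV.Beta.GAN24.TopLagrangeKSlot (midConst midConst_nonneg)
open Summit.QuantumFields.BalabanUV.Beta.GAN24.TopLagrangeKSlotLip (kerConst lipKerConst kerConst_nonneg)
open Summit.QuantumFields.BalabanUV.Beta.GAN24.TopLagrangeKSlotAt (lamTopKerAt unit_e3OfS_lamTop_eq)
open Summit.QuantumFields.BalabanUV.Beta.GAN24.TopLagrangeKSlotLipAt (biLoc_lamTopKer biLoc_lamTopKer_sub)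
open Summit.QuantumFields.BalabanUV.Beta.GAN24.S3DiffLt (lipKerConst_mul lipKerConst_nonneg)

namespace Summit.QuantumFields.BalabanUV.Beta.GAN24.S3DiffLtAt

variable {d : ℕ}

/-! ## §1 Generic `d`: the two rows from the K-slot predicates -/

section Generic

variable {Lc : ℕ} [NeZero Lc] {r : Fin (d + 1) → ℕ}

/-- **ROW S3-Lt AT THE IN-BLOCK ROOT, FROM THE K-SLOT'S UNIFORM DECAY** (generic `d`, root `r ∈ box (d+1) Lc`, SAME constant as the corner root; [folklore]∕NOT IN PRINT; the hypothesis `hLt` of `StencilSlotE3OfPieces.e3Shape_of_pieces`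
VERBATIM as conclusion, member `n+2`, with the n-FREE constant `CtL = |cΛ|·Lc^{2(d+1)}·kerConst d Lc C C C δ` and locality rate `δ/8`, `(C, δ)` = the data of
`UnitDecayK d Lc (sfStep Lc) (smStep d Lc) C δ`).  Mechanism: `unit_e3OfS_lamTop_eq` + `biLoc_lamTopKer` at `K₁ = K₂ = K₃ = K̃ᵘ_{n+1}`.  NO (N1).
Discharges nothing of (hS, hSall) by itself; NOT BetaPertH, NOT continuum, NOT Clay. -/
theorem shapeLt_of_unitDecayK (hLc : 1 ≤ Lc) (hr : r ∈ box (d + 1) Lc) (cΛ : ℝ) {C δ : ℝ} (hK : UnitDecayK d Lc (sfStep Lc) (smStep d Lc) C δ) (hδ : 0 < δ) :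
    ∀ n : ℕ, LocStencil (fun κ' u' x' z' a b => ((Lc : ℝ) ^ (n + 1 + 1)) ^ (2 * (d + 1)) *
      e3OfS (Lc ^ (n + 1 + 1)) (fun κ u => (cΛ * ((Lc : ℝ) ^ (n + 1)) ^ (2 * d + 4)) •
        lagrIncAt d (toSite r) Lc (Lc ^ (n + 1)) (Lc ^ (n + 1 + 1)) κ u) κ' u' x' z' a b)
      (|cΛ| * (Lc : ℝ) ^ (2 * (d + 1)) * kerConst d Lc C C C δ) (δ / 8) := by
  intro n κ' u' x' z' a b
  dsimp only
  have hb := biLoc_lamTopKer hLc hr (hK (n + 1)) (hK (n + 1)) (hK (n + 1)) hδ κ' u' x' z' a b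
  dsimp only [CombesThomas.UnitDecayK, CombesThomas.UniformDecays] at hb
  have hL : (0 : ℝ) ≤ (Lc : ℝ) ^ (2 * (d + 1)) := by positivity
  rw [unit_e3OfS_lamTop_eq hLc hr cΛ (n + 1) κ' u' x' z' a b, abs_mul, abs_mul, abs_of_nonneg hL]
  calc |cΛ| * (Lc : ℝ) ^ (2 * (d + 1)) * |lamTopKerAt (toSite r) Lc (unitK (sfStep Lc (n + 1)) (smStep d Lc (n + 1)) (KInvStep (d := d) Lc (n + 1)))
          (unitK (sfStep Lc (n + 1)) (smStep d Lc (n + 1)) (KInvStep (d := d) Lc (n + 1)))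
          (unitK (sfStep Lc (n + 1)) (smStep d Lc (n + 1)) (KInvStep (d := d) Lc (n + 1))) κ' u' x' z' a b|
      ≤ |cΛ| * (Lc : ℝ) ^ (2 * (d + 1)) * (kerConst d Lc C C C δ * Real.exp (-(δ / 8) * (l1 (x' - u') + l1 (z' - u')))) :=
        mul_le_mul_of_nonneg_left hb (mul_nonneg (abs_nonneg _) hL)
    _ = _ := by ring

/-- **ROW R3-dLt AT THE IN-BLOCK ROOT, FROM THE K-SLOT'S ONE-STEP CAUCHY RATE** (generic `d`, root `r ∈ box (d+1) Lc`, SAME constant as the corner root; [folklore]∕NOT IN PRINT; the hypothesis `dLt` of `StencilSlotE3RateOfPieces.e3SupRate_of_pieces`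
VERBATIM as conclusion — the depth-paired one-step DIFFERENCE of the unit-rescaled top Λ pieces of members `n+3` and `n+2` — with
`cLt = |cΛ|·Lc^{2(d+1)}·lipKerConst d Lc C C C C δ cK cK cK` and THE K-SLOT'S OWN RATE `θ` (`UnitDecayK … C δ`, `CauchyDecayK … cK θ δ`; nothing
strengthened).  Mechanism: both members are `cΛ·Lc^{2(d+1)} · lamTopKer Lc K K K` at `K = K̃ᵘ_{n+2}` resp. `K̃ᵘ_{n+1}` (`unit_e3OfS_lamTop_eq`), and `lamTopKer` is
Lipschitz in its three slots (`biLoc_lamTopKer_sub`) with all three deviations `Decays (K̃ᵘ_{n+2} − K̃ᵘ_{n+1}) (cK·θ^{n+1}) δ`.  NO (N1), NO (N1-Cauchy).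
Discharges nothing of (hS, hSall) by itself; NOT BetaPertH, NOT continuum, NOT Clay. -/
theorem diffLt_of_unitDecayK_cauchyDecayK (hLc : 1 ≤ Lc) (hr : r ∈ box (d + 1) Lc) (cΛ : ℝ) {C cK θ δ : ℝ}
    (hK : UnitDecayK d Lc (sfStep Lc) (smStep d Lc) C δ) (hC : CauchyDecayK d Lc (sfStep Lc) (smStep d Lc) cK θ δ) (hδ : 0 < δ)
    (hθ : 0 ≤ θ) :
    ∀ (n : ℕ) (κ' : Fin (d + 1)) (u' : Fin (d + 1) → ℤ), SupBound (fun x z a b =>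
      ((Lc : ℝ) ^ (n + 1 + 1 + 1)) ^ (2 * (d + 1)) * e3OfS (Lc ^ (n + 1 + 1 + 1))
          (fun κ u => (cΛ * ((Lc : ℝ) ^ (n + 1 + 1)) ^ (2 * d + 4)) • lagrIncAt d (toSite r) Lc (Lc ^ (n + 1 + 1)) (Lc ^ (n + 1 + 1 + 1)) κ u)
          κ' u' x z a b -
        ((Lc : ℝ) ^ (n + 1 + 1)) ^ (2 * (d + 1)) * e3OfS (Lc ^ (n + 1 + 1))
          (fun κ u => (cΛ * ((Lc : ℝ) ^ (n + 1)) ^ (2 * d + 4)) • lagrIncAt d (toSite r) Lc (Lc ^ (n + 1)) (Lc ^ (n + 1 + 1)) κ u) κ' u' x z a b)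
      (|cΛ| * (Lc : ℝ) ^ (2 * (d + 1)) * lipKerConst d Lc C C C C δ cK cK cK * θ ^ (n + 1)) := by
  intro n κ' u' x z a b
  dsimp only
  have hCn : 0 ≤ C := (hK 0).nonneg (Sum.inl 0)
  have hcK : 0 ≤ cK := by
    have h := (hC 0 0).nonneg (Sum.inl 0)
    simpa using h
  have hd : Decays (unitK (sfStep Lc (n + 1 + 1)) (smStep d Lc (n + 1 + 1)) (KInvStep (d := d) Lc (n + 1 + 1)) -
      unitK (sfStep Lc (n + 1)) (smStep d Lc (n + 1)) (KInvStep (d := d) Lc (n + 1))) (θ ^ (n + 1) * cK) δ := by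
    rw [mul_comm]
    exact hC (n + 1) 1
  have hb := biLoc_lamTopKer_sub hLc hr (hK (n + 1)) (hK (n + 1)) (hK (n + 1)) (hK (n + 1 + 1)) (hK (n + 1 + 1)) (hK (n + 1 + 1))
    hd hd hd hδ κ' u' x z a b
  dsimp only at hb
  have hL : (0 : ℝ) ≤ (Lc : ℝ) ^ (2 * (d + 1)) := by positivity
  have hlip : 0 ≤ lipKerConst d Lc C C C C δ cK cK cK := lipKerConst_nonneg Lc hCn hCn hCn hCn hδ hcK hcK hcK
  have hexp : Real.exp (-(δ / 8) * (l1 (x - u') + l1 (z - u'))) ≤ 1 :=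
    Real.exp_le_one_iff.mpr (by nlinarith [l1_nonneg (x - u'), l1_nonneg (z - u')])
  rw [unit_e3OfS_lamTop_eq hLc hr cΛ (n + 1 + 1) κ' u' x z a b, unit_e3OfS_lamTop_eq hLc hr cΛ (n + 1) κ' u' x z a b, ← mul_sub,
    abs_mul, abs_mul, abs_of_nonneg hL]
  rw [Pi.sub_apply, Pi.sub_apply, Pi.sub_apply, Pi.sub_apply, lipKerConst_mul] at hb
  calc |cΛ| * (Lc : ℝ) ^ (2 * (d + 1)) * |_|
      ≤ |cΛ| * (Lc : ℝ) ^ (2 * (d + 1)) *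
          (θ ^ (n + 1) * lipKerConst d Lc C C C C δ cK cK cK * Real.exp (-(δ / 8) * (l1 (x - u') + l1 (z - u')))) :=
        mul_le_mul_of_nonneg_left hb (mul_nonneg (abs_nonneg _) hL)
    _ ≤ |cΛ| * (Lc : ℝ) ^ (2 * (d + 1)) * (θ ^ (n + 1) * lipKerConst d Lc C C C C δ cK cK cK * 1) := by
        have h0 : 0 ≤ θ ^ (n + 1) * lipKerConst d Lc C C C C δ cK cK cK := mul_nonneg (pow_nonneg hθ _) hlip
        exact mul_le_mul_of_nonneg_left (mul_le_mul_of_nonneg_left hexp h0) (mul_nonneg (abs_nonneg _) hL)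
    _ = _ := by ring

end Generic

/-! ## §2 `d = 3`, `Lc ≥ 2`: the RATE row UNCONDITIONALLY, from road P1's K-slot theorem `KSlotAssembly.convCKWall_holds` -/

section Three

variable {Lc : ℕ} [NeZero Lc]

/-- **ROW R3-dLt AT EVERY IN-BLOCK ROOT, `d = 3`, `Lc ≥ 2`, UNCONDITIONALLY — THE UNDRESSED TOP-ALIGNED PAIR LETTER FOR THE LENGTH-ONE LINEAGES (`k = i+1`, births `i ≥ 1`) of `GAN24/BornLambdaDriftSup`'s socket in road S3's units** ([folklore]∕NOT IN PRINT): `∃ cLt θ, 0 ≤ cLt ∧ 0 ≤ θ ∧ θ < 1 ∧ ∀ r ∈ box, dLt` (the hypothesis of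
`StencilSlotE3RateOfPieces.e3SupRate_of_pieces`, `d = 3` fully specialised; `θ` = THE K-SLOT'S RATE of `ConvCKWall 3 Lc`), from
`KSlotAssembly.convCKWall_holds` (road P1) through `diffLt_of_unitDecayK_cauchyDecayK`.  NO (N1), NO (N1-Cauchy).  One hypothesis of the RATE END;
discharges nothing of (hS, hSall) by itself; NOT BetaPertH, NOT continuum, NOT Clay. -/
theorem diffLt_three_at (hLc : 2 ≤ Lc) (cΛ : ℝ) :
    ∃ cLt θ : ℝ, 0 ≤ cLt ∧ 0 ≤ θ ∧ θ < 1 ∧ ∀ (r : Fin (3 + 1) → ℕ), r ∈ box (3 + 1) Lc →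
      ∀ (n : ℕ) (κ' : Fin (3 + 1)) (u' : Fin (3 + 1) → ℤ), SupBound (fun x z a b =>
      ((Lc : ℝ) ^ (n + 1 + 1 + 1)) ^ (2 * (3 + 1)) * e3OfS (d := 3) (Lc ^ (n + 1 + 1 + 1))
          (fun κ u => (cΛ * ((Lc : ℝ) ^ (n + 1 + 1)) ^ (2 * 3 + 4)) • lagrIncAt 3 (toSite r) Lc (Lc ^ (n + 1 + 1)) (Lc ^ (n + 1 + 1 + 1)) κ u)
          κ' u' x z a b -
        ((Lc : ℝ) ^ (n + 1 + 1)) ^ (2 * (3 + 1)) * e3OfS (d := 3) (Lc ^ (n + 1 + 1))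
          (fun κ u => (cΛ * ((Lc : ℝ) ^ (n + 1)) ^ (2 * 3 + 4)) • lagrIncAt 3 (toSite r) Lc (Lc ^ (n + 1)) (Lc ^ (n + 1 + 1)) κ u) κ' u' x z a b)
      (cLt * θ ^ (n + 1)) := by
  obtain ⟨C, δ, cK, θ, hδ, hθ0, hθ1, hU, hCau⟩ := KSlotAssembly.convCKWall_holds (Lc := Lc) hLc
  have hC : 0 ≤ C := (hU 0).nonneg (Sum.inl 0)
  have hcK : 0 ≤ cK := by
    have h := (hCau 0 0).nonneg (Sum.inl 0)
    simpa using h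
  refine ⟨|cΛ| * (Lc : ℝ) ^ (2 * (3 + 1)) * lipKerConst 3 Lc C C C C δ cK cK cK, θ, ?_, hθ0, hθ1, ?_⟩
  · have := lipKerConst_nonneg (d := 3) Lc hC hC hC hC hδ hcK hcK hcK
    positivity
  · exact fun r hr => diffLt_of_unitDecayK_cauchyDecayK (d := 3) (by omega) hr cΛ hU hCau hδ hθ0

end Three

end Summit.QuantumFields.BalabanUV.Beta.GAN24.S3DiffLtAt

end
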